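import Mathlib
import Summits.CriticalPhenomena.PercolationContinuityZ3.Theorems.PercNearOneGluingNoHeavyLowerTailOrderedDifferences
import Summits.CriticalPhenomena.PercolationContinuityZ3.Theorems.PercNearOneGluingNoHeavyLowerTailOrientedAntipodalHall

/-!
# Conjecture W2: the label-level (block-pattern) certificate

Helper file for crux `stmt-CriticalPhenomena-4575` (`NoHeavyLowerTail`, route `PercNearOneGluingNoHeavy`),
new-inequality factory seat `prim-ineq-gen-3` (gen 17); companion of `…OrientedAntipodalHallWordsTwo` (memo
`run/shared/lean/prim/prim-ineq-gen-3/CONJECTURE-W2.md` §2–3).  Everything here is PROVED; no definitions.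

`card_le_card_wordsTwo_of_pattern`: file each TYPE of bad complemented or plain and rank the types; if equally filed types
never form a 2-path, complemented types precede plain ones and differ from them in both petals, and members meet the other
bads, then the block-ranked ordered Marica–Schönheim inequality (`OrderedDifferences.card_le_card_of_rank`) runs entirely
inside the co-good WORDS OF LENGTH TWO (member differences for equally filed pairs, member meets for complemented-before-
plain pairs), giving the count `#D ≤ #W2(D)` of Conjecture W2.  This is exactly the reach of W2 'at label level': one type
(Marica–Schönheim), 2-path-free type sets, a 2-path or opposite pair (MS2′), directed paths of any length, and every type
set whose touching structure admits such a filing; the two triangles do not (CONJECTURE-W2.md §2), and there W2 is open.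
(prim-ineq-gen-3 gen 17, 2026-08-22.)
-/

namespace Summit.CriticalPhenomena.PercolationContinuityZ3.Theorems

namespace OrientedAntipodalHall

open Finset AntipodalStrongHarris AntipodalStrongHarris.Lab OrderedDifferences
open scoped FinsetFamily

variable {α : Type*} [DecidableEq α] {k : ℕ}

/-- **Label-level W2 certificates (the block-pattern theorem).**  File every type `(p,q)` of bads either COMPLEMENTED
(`cpl p q = true`: the member `S \ X` represents `X`) or PLAIN (`cpl p q = false`: `X` represents itself) and give it a block
rank `ρ p q`.  Suppose: members pairwise meet the other bads (`¬ S \ X ⊆ Y`, co-intersection); two EQUALLY filed types never form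
a 2-path (`j X ≠ i Y`); and a complemented type always precedes a plain one (`ρ` smaller) and differs from it in BOTH petals.  Then
ordered Marica–Schönheim over the representatives (blocks by `ρ`, larger sets first inside a block) produces only words of length
two that are co-goods — member differences for equally filed pairs, member MEETS for complemented-before-plain pairs — so
`#D ≤ #W2(D)`.  `card_le_card_wordsTwo_of_noTwoPath` (everything complemented, one block) and
`card_add_card_le_card_wordsTwo_of_twoPath` (one complemented block, one plain block) are the two simplest patterns; paths of
any length and, more generally, every type set whose 'touching graph' admits such a 2-colouring are covered. -/
theorem card_le_card_wordsTwo_of_pattern (S : Finset α) {f : Finset α → Lab k}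
    (hf : ∀ ⦃X Y : Finset α⦄, X ⊆ Y → f X ≤ f Y) (D : Finset (Finset α)) (i j : Finset α → Fin k)
    (hDS : ∀ X ∈ D, X ⊆ S) (hDi : ∀ X ∈ D, f X = petal (i X)) (hDj : ∀ X ∈ D, f (S \ X) = petal (j X))
    (cpl : Fin k → Fin k → Bool) (ρ : Fin k → Fin k → ℕ)
    (hCoI : ∀ X ∈ D, ∀ Y ∈ D, ¬ S \ X ⊆ Y)
    (hsame : ∀ X ∈ D, ∀ Y ∈ D, cpl (i X) (j X) = cpl (i Y) (j Y) → j X ≠ i Y)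
    (hmix : ∀ X ∈ D, ∀ Y ∈ D, cpl (i X) (j X) = true → cpl (i Y) (j Y) = false →
      ρ (i X) (j X) < ρ (i Y) (j Y) ∧ i X ≠ i Y ∧ j X ≠ j Y) :
    #D ≤ #{G ∈ S.powerset | f G = bot ∧ f (S \ G) = top ∧
      ∃ X ∈ D, ∃ Y ∈ D, G = (S \ X) \ (S \ Y) ∨ G = (S \ X) ∩ (S \ Y)} := by
  classical
  -- representatives and ranks
  let A : D → Finset α := fun X => if cpl (i X.1) (j X.1) = true then S \ X.1 else X.1
  let r : D → ℕ := fun X => ρ (i X.1) (j X.1) * (#S + 1) + (#S - #(A X))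
  have hAS : ∀ X : D, A X ⊆ S := by
    intro X
    by_cases hc : cpl (i X.1) (j X.1) = true
    · simp only [A, hc, if_true]; exact sdiff_subset
    · simp only [A, hc]; exact hDS _ X.2
  -- rank comparison decoded: `r X ≤ r Y` gives `ρ X ≤ ρ Y`, and equal `ρ` forces `#A Y ≤ #A X`
  have hrle : ∀ X Y : D, r X ≤ r Y → ρ (i X.1) (j X.1) ≤ ρ (i Y.1) (j Y.1) := by
    intro X Y h
    have h1 : #S - #(A X) ≤ #S := Nat.sub_le _ _
    have h2 : #S - #(A Y) ≤ #S := Nat.sub_le _ _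
    by_contra hlt
    push Not at hlt
    have : ρ (i Y.1) (j Y.1) + 1 ≤ ρ (i X.1) (j X.1) := hlt
    have key : ρ (i Y.1) (j Y.1) * (#S + 1) + (#S + 1) ≤ ρ (i X.1) (j X.1) * (#S + 1) := by nlinarith
    simp only [r] at h
    omega
  have hreq : ∀ X Y : D, r X ≤ r Y → ρ (i X.1) (j X.1) = ρ (i Y.1) (j Y.1) → #(A Y) ≤ #(A X) := by
    intro X Y h he
    have hXS : #(A X) ≤ #S := card_le_card (hAS X)
    have hYS : #(A Y) ≤ #S := card_le_card (hAS Y)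
    simp only [r, he] at h
    omega
  -- same type forces comparable labels: containment between representatives of equally filed bads only inside a type
  have hsub_type : ∀ X ∈ D, ∀ Y ∈ D, X ⊆ Y → i X = i Y ∧ j X = j Y := by
    intro X hX Y hY hXY
    have h1 : petal (i X) ≤ petal (i Y) := by rw [← hDi X hX, ← hDi Y hY]; exact hf hXY
    have h2 : petal (j Y) ≤ petal (j X) := by
      rw [← hDj X hX, ← hDj Y hY]; exact hf (sdiff_subset_sdiff le_rfl hXY)
    rw [le_def] at h1 h2
    have hi : i X = i Y := by
      rcases h1 with h | h | h
      · exact absurd h (by intro h0; cases h0)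
      · exact absurd h (by intro h0; cases h0)
      · exact Lab.petal.inj h
    have hj : j X = j Y := by
      rcases h2 with h | h | h
      · exact absurd h (by intro h0; cases h0)
      · exact absurd h (by intro h0; cases h0)
      · exact (Lab.petal.inj h).symm
    exact ⟨hi, hj⟩
  -- (1) non-containment for rank-ordered pairs
  have hA : ∀ ⦃x y : D⦄, x ≠ y → r x ≤ r y → ¬ A x ⊆ A y := by
    intro x y hne hle hsub
    have hxD := x.2; have hyD := y.2
    by_cases hcx : cpl (i x.1) (j x.1) = true <;> by_cases hcy : cpl (i y.1) (j y.1) = true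
    · -- both complemented: S \ x ⊆ S \ y ⇒ y ⊆ x ⇒ same type; then sizes decide
      have hAx : A x = S \ x.1 := by simp only [A, hcx, if_true]
      have hAy : A y = S \ y.1 := by simp only [A, hcy, if_true]
      rw [hAx, hAy] at hsub
      have hyx : y.1 ⊆ x.1 := by
        intro a ha
        by_contra hax
        have : a ∈ S \ y.1 := hsub (mem_sdiff.mpr ⟨hDS _ hyD ha, hax⟩)
        exact (mem_sdiff.mp this).2 ha
      obtain ⟨hi, hj⟩ := hsub_type _ hyD _ hxD hyx
      have heq : ρ (i x.1) (j x.1) = ρ (i y.1) (j y.1) := by rw [hi, hj]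
      have hcard := hreq x y hle heq
      rw [hAx, hAy] at hcard
      have hle' : #(S \ x.1) ≤ #(S \ y.1) := card_le_card hsub
      have heqs : S \ x.1 = S \ y.1 := eq_of_subset_of_card_le hsub hcard
      apply hne
      apply Subtype.ext
      rw [← Finset.sdiff_sdiff_eq_self (hDS _ hxD), ← Finset.sdiff_sdiff_eq_self (hDS _ hyD), heqs]
    · -- x complemented, y plain: S \ x ⊆ y contradicts co-intersection
      have hAx : A x = S \ x.1 := by simp only [A, hcx, if_true]
      have hAy : A y = y.1 := by simp only [A, hcy]; simp
      rw [hAx, hAy] at hsub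
      exact hCoI _ hxD _ hyD hsub
    · -- x plain, y complemented: impossible order (plain ranks are larger)
      have hcy' : cpl (i y.1) (j y.1) = true := hcy
      have hcx' : cpl (i x.1) (j x.1) = false := by simpa using hcx
      have hlt := (hmix _ hyD _ hxD hcy' hcx').1
      have := hrle x y hle
      omega
    · -- both plain: x ⊆ y ⇒ same type; sizes decide
      have hAx : A x = x.1 := by simp only [A, hcx]; simp
      have hAy : A y = y.1 := by simp only [A, hcy]; simp
      rw [hAx, hAy] at hsub
      obtain ⟨hi, hj⟩ := hsub_type _ hxD _ hyD hsub
      have heq : ρ (i x.1) (j x.1) = ρ (i y.1) (j y.1) := by rw [hi, hj]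
      have hcard := hreq x y hle heq
      rw [hAx, hAy] at hcard
      have heqs : x.1 = y.1 := eq_of_subset_of_card_le hsub hcard
      exact hne (Subtype.ext heqs)
  -- (2) every rank-ordered difference is a co-good word of length two
  have hT : ∀ ⦃x y : D⦄, r x ≤ r y → A x \ A y ∈ ({G ∈ S.powerset | f G = bot ∧ f (S \ G) = top ∧
      ∃ X ∈ D, ∃ Y ∈ D, G = (S \ X) \ (S \ Y) ∨ G = (S \ X) ∩ (S \ Y)} : Finset (Finset α)) := by
    intro x y hle
    have hxD := x.2; have hyD := y.2
    have hxS := hDS _ hxD; have hyS := hDS _ hyD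
    rw [mem_filter, mem_powerset]
    by_cases hcx : cpl (i x.1) (j x.1) = true <;> by_cases hcy : cpl (i y.1) (j y.1) = true
    · -- comp / comp: (S \ x) \ (S \ y) = y \ x, types form no 2-path
      have hAx : A x = S \ x.1 := by simp only [A, hcx, if_true]
      have hAy : A y = S \ y.1 := by simp only [A, hcy, if_true]
      rw [hAx, hAy]
      have hne1 : j x.1 ≠ i y.1 := hsame _ hxD _ hyD (by rw [hcx, hcy])
      have hne2 : j y.1 ≠ i x.1 := hsame _ hyD _ hxD (by rw [hcx, hcy])
      have hGy : (S \ x.1) \ (S \ y.1) ⊆ y.1 := by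
        intro a ha
        rw [mem_sdiff, mem_sdiff, mem_sdiff] at ha
        by_contra h
        exact ha.2 ⟨ha.1.1, h⟩
      have hsupx : x.1 ⊆ S \ ((S \ x.1) \ (S \ y.1)) := by
        intro a ha
        exact mem_sdiff.mpr ⟨hxS ha, fun h => (mem_sdiff.mp (mem_sdiff.mp h).1).2 ha⟩
      have hsupy : S \ y.1 ⊆ S \ ((S \ x.1) \ (S \ y.1)) := sdiff_subset_sdiff le_rfl hGy
      refine ⟨sdiff_subset.trans sdiff_subset, ?_, ?_, x.1, hxD, y.1, hyD, Or.inl rfl⟩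
      · refine eq_bot_of_le_petal hne1 ?_ ?_
        · rw [← hDj _ hxD]; exact hf sdiff_subset
        · rw [← hDi _ hyD]; exact hf hGy
      · refine eq_top_of_petal_le hne2.symm ?_ ?_
        · rw [← hDi _ hxD]; exact hf hsupx
        · rw [← hDj _ hyD]; exact hf hsupy
    · -- comp / plain: (S \ x) \ y = (S \ x) ∩ (S \ y), petals differ on both sides
      have hAx : A x = S \ x.1 := by simp only [A, hcx, if_true]
      have hAy : A y = y.1 := by simp only [A, hcy]; simp
      rw [hAx, hAy]
      have hcy' : cpl (i y.1) (j y.1) = false := by simpa using hcy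
      obtain ⟨-, hii, hjj⟩ := hmix _ hxD _ hyD hcx hcy'
      have heq : (S \ x.1) \ y.1 = (S \ x.1) ∩ (S \ y.1) := by
        ext a
        simp only [mem_sdiff, mem_inter]
        tauto
      have hsupx : x.1 ⊆ S \ ((S \ x.1) \ y.1) := by
        intro a ha
        exact mem_sdiff.mpr ⟨hxS ha, fun h => (mem_sdiff.mp (mem_sdiff.mp h).1).2 ha⟩
      have hsupy : y.1 ⊆ S \ ((S \ x.1) \ y.1) := by
        intro a ha
        exact mem_sdiff.mpr ⟨hyS ha, fun h => (mem_sdiff.mp h).2 ha⟩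
      refine ⟨sdiff_subset.trans sdiff_subset, ?_, ?_, x.1, hxD, y.1, hyD, Or.inr heq⟩
      · refine eq_bot_of_le_petal hjj ?_ ?_
        · rw [← hDj _ hxD]; exact hf sdiff_subset
        · rw [← hDj _ hyD]; exact hf (sdiff_subset_sdiff sdiff_subset le_rfl)
      · refine eq_top_of_petal_le hii ?_ ?_
        · rw [← hDi _ hxD]; exact hf hsupx
        · rw [← hDi _ hyD]; exact hf hsupy
    · -- plain / comp: excluded by the ranks
      have hcy' : cpl (i y.1) (j y.1) = true := hcy
      have hcx' : cpl (i x.1) (j x.1) = false := by simpa using hcx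
      have hlt := (hmix _ hyD _ hxD hcy' hcx').1
      have := hrle x y hle
      omega
    · -- plain / plain: x \ y = (S \ y) \ (S \ x), types form no 2-path
      have hAx : A x = x.1 := by simp only [A, hcx]; simp
      have hAy : A y = y.1 := by simp only [A, hcy]; simp
      rw [hAx, hAy]
      have hcx' : cpl (i x.1) (j x.1) = false := by simpa using hcx
      have hcy' : cpl (i y.1) (j y.1) = false := by simpa using hcy
      have hne1 : j x.1 ≠ i y.1 := hsame _ hxD _ hyD (by rw [hcx', hcy'])
      have hne2 : j y.1 ≠ i x.1 := hsame _ hyD _ hxD (by rw [hcx', hcy'])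
      have heq : x.1 \ y.1 = (S \ y.1) \ (S \ x.1) := by
        ext a
        simp only [mem_sdiff]
        constructor
        · rintro ⟨hax, hay⟩
          exact ⟨⟨hxS hax, hay⟩, fun h => h.2 hax⟩
        · rintro ⟨⟨haS, hay⟩, h⟩
          refine ⟨?_, hay⟩
          by_contra hax
          exact h ⟨haS, hax⟩
      have hsupy : y.1 ⊆ S \ (x.1 \ y.1) := by
        intro a ha
        exact mem_sdiff.mpr ⟨hyS ha, fun h => (mem_sdiff.mp h).2 ha⟩
      have hsupx : S \ x.1 ⊆ S \ (x.1 \ y.1) := sdiff_subset_sdiff le_rfl sdiff_subset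
      refine ⟨sdiff_subset.trans hxS, ?_, ?_, y.1, hyD, x.1, hxD, Or.inl heq⟩
      · refine eq_bot_of_le_petal hne2.symm ?_ ?_
        · rw [← hDi _ hxD]; exact hf sdiff_subset
        · rw [← hDj _ hyD]; exact hf (sdiff_subset_sdiff hxS le_rfl)
      · refine eq_top_of_petal_le hne1.symm ?_ ?_
        · rw [← hDi _ hyD]; exact hf hsupy
        · rw [← hDj _ hxD]; exact hf hsupx
  have hmain := card_le_card_of_rank A r hA _ hT
  rwa [Fintype.card_coe] at hmain

end OrientedAntipodalHall

end Summit.CriticalPhenomena.PercolationContinuityZ3.Theorems
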